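import Summits.CriticalPhenomena.Ising3DConformalLimit.Theses.PerfectScreening
import Summits.CriticalPhenomena.Ising3DConformalLimit.Theorems.MoebiusLimitOfTwoPointLaw.Negative.CanonicalForm
import Literature.Probability.LatticeModels.CriticalScalingDimension
import Literature.Probability.LatticeModels.TwoPointSupNormMonotone
import Literature.Probability.LatticeModels.CriticalTwoPointBounds
import HarnessLib

/-!
# `PerfectScreening.GaussianLimitIsCoulomb` (item stmt-CriticalPhenomena-1343): axis reduction and
# the renormalisation form of the item

THEOREM-ONLY file (no definitions, no named facts), `--supports stmt-CriticalPhenomena-1343`,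
complementing `PerfectScreeningGaussianLimitIsCoulombReductions.lean`. The item's conclusion is
the LATTICE Coulomb lower bound `∃ c > 0, ∀ x ≠ 0, c/‖x‖ ≤ ⟨σ₀σ_x⟩_{β_c}` on `ℤ³` (sup norm).

* §1 (lattice, Messager–Miracle-Solé): the Coulomb bound is AXIAL and EVENTUAL —
  `coulomb_iff_eventually_axis` (`⟨σ₀σ_{m e₀}⟩ ≤ ⟨σ₀σ_x⟩` for `m ≥ 3‖x‖_∞`, tree theorem
  `twoPointPlus_le_of_mul_supNorm_le` = ADC21 (5.3)); hence `not_coulomb_iff_nonSaturation`: its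
  negation is EXACTLY the route's support item `NonSaturation` (stmt-CriticalPhenomena-1342).
* §2 (logical position): `gaussianLimitIsCoulomb_iff_nonSaturation_imp` —
  `GaussianLimitIsCoulomb ↔ (NonSaturation → every non-degenerate Möbius-covariant pointwise
  scaling limit of criticalCorr 3 has U₄ ≢ 0)`: the item is "the weakest form of `η > 0` forbids a
  Gaussian conformal limit"; it follows from Möbius-restricted non-Gaussianity (cf. item 0636) and,
  trivially, from saturation of the infrared bound.
* §3 (renormalisation): under the limit hypothesis at `n = 2` alone,
  `ρ(δ)²·⟨σ₀σ_{⌊1/δ⌋e₀}⟩ → S₂(0,e₀)` (`tendsto_rho_sq_mul_axis`); the infrared bound gives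
  `ρ(δ)² ≥ c/δ` near `0⁺` (`renormalisation_lower_bound`), and Coulomb ⇔ `δ·ρ(δ)²` bounded near
  `0⁺` (`coulomb_iff_isBoundedUnder_renormalisation`). Hence
  `gaussianLimitIsCoulomb_iff_canonicalRenormalisation`: the item says that a Gaussian Möbius limit
  of the nearest-neighbour model is reached with the CANONICAL free-field renormalisation
  `ρ(δ)² ≍ δ^{-1} = δ^{-(d-2)}` ("`Z ∈ (0,∞)`", the mean-field normalisation of `d ≥ 5`).

References: A. Messager, S. Miracle-Solé, J. Stat. Phys. 17 (1977) 245–262; M. Aizenman,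
H. Duminil-Copin, Ann. of Math. 194 (2021) = arXiv:1912.07973, §5.1 eq. (5.3); H. Duminil-Copin,
*Lectures on the Ising and Potts models* (2019), Thm. 4.8.
-/

noncomputable section

namespace Summit.CriticalPhenomena.Ising3DConformalLimit.PerfectScreeningGaussianLimitIsCoulomb

open Literature.Probability.LatticeModels Filter Set
open scoped Topology
open Summit.CriticalPhenomena.Ising3DConformalLimit.Theses
open Summit.CriticalPhenomena.Ising3DConformalLimit.Theorems.MoebiusLimitOfTwoPointLaw.Negative
  (rescaledCorrelator_criticalCorr_unitVec)

/-! ### §1 The Coulomb lower bound is an axial, eventual statement -/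

/-- **Messager–Miracle-Solé, axis form at `β_c(3)`**: for `x ∈ ℤ³` and `m ≥ 3‖x‖_∞`,
`⟨σ₀σ_{m e₀}⟩_{β_c} ≤ ⟨σ₀σ_x⟩_{β_c}` (ADC21 eq. (5.3), tree theorem
`twoPointPlus_le_of_mul_supNorm_le`). [cite: AizenmanDuminilCopinAnnals2021, §5.1 eq. (5.3)] -/
theorem criticalTwoPoint_axis_le (x : Site 3) {m : ℕ} (hm : 3 * Site.supNorm x ≤ m) :
    criticalTwoPoint 3 (Pi.single 0 (m : ℤ)) ≤ criticalTwoPoint 3 x := by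
  have hsup : 3 * Site.supNorm x ≤ Site.supNorm (Pi.single (0 : Fin 3) (m : ℤ) : Site 3) := by
    refine hm.trans ?_
    have h := Site.natAbs_le_supNorm (Pi.single (0 : Fin 3) (m : ℤ) : Site 3) 0
    simpa using h
  exact twoPointPlus_le_of_mul_supNorm_le (d := 3) (criticalBeta_nonneg (d := 3)) hsup

/-- **Eventual axial Coulomb ⇒ global Coulomb.** If `c ≤ n·⟨σ₀σ_{n e₀}⟩_{β_c}` for all `n ≥ N`
(`c > 0`), then `c'/‖x‖ ≤ ⟨σ₀σ_x⟩_{β_c}` for EVERY `x ≠ 0`, with `c' = c/(3+N)`: for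
`m = ‖x‖_∞ ≥ 1` compare with the axis site `n = 3m + N ≥ N` (Messager–Miracle-Solé), where
`n ≤ (3+N)m`. No separate treatment of small `x` is needed. [folklore] -/
theorem coulomb_of_eventually_axis {c : ℝ} (hc : 0 < c) {N : ℕ}
    (h : ∀ n : ℕ, N ≤ n → c ≤ n * criticalTwoPoint 3 (Pi.single 0 (n : ℤ))) :
    ∃ c' : ℝ, 0 < c' ∧ ∀ x : Site 3, x ≠ 0 → c' / ‖x‖ ≤ criticalTwoPoint 3 x := by
  refine ⟨c / (3 + N), by positivity, fun x hx => ?_⟩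
  set m := Site.supNorm x with hm
  have hm1 : 1 ≤ m := Nat.one_le_iff_ne_zero.2 fun h0 => hx (Site.supNorm_eq_zero_iff.1 h0)
  have hnorm : ‖x‖ = (m : ℝ) := Site.norm_eq_supNorm x
  have hmpos : (0 : ℝ) < m := by exact_mod_cast hm1
  set n := 3 * m + N with hn
  have h1 : c ≤ n * criticalTwoPoint 3 (Pi.single 0 (n : ℤ)) := h n (by omega)
  have h2 : criticalTwoPoint 3 (Pi.single 0 (n : ℤ)) ≤ criticalTwoPoint 3 x :=
    criticalTwoPoint_axis_le x (by omega)
  have hnpos : (0 : ℝ) < n := Nat.cast_pos.2 (by omega)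
  have hGpos : 0 < criticalTwoPoint 3 x := by
    have : 0 < (n : ℝ) * criticalTwoPoint 3 (Pi.single 0 (n : ℤ)) := hc.trans_le h1
    exact lt_of_lt_of_le (pos_of_mul_pos_right this hnpos.le) h2
  have hnle : (n : ℝ) ≤ (3 + N) * m := by
    have : (n : ℝ) = 3 * m + N := by rw [hn]; push_cast; ring
    rw [this]
    have hN0 : (0 : ℝ) ≤ N := Nat.cast_nonneg N
    have hm1' : (1 : ℝ) ≤ m := by exact_mod_cast hm1
    nlinarith [mul_nonneg hN0 (sub_nonneg.2 hm1')]
  rw [hnorm, div_le_iff₀ hmpos, div_le_iff₀ (by positivity)]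
  calc c ≤ n * criticalTwoPoint 3 (Pi.single 0 (n : ℤ)) := h1
    _ ≤ n * criticalTwoPoint 3 x := mul_le_mul_of_nonneg_left h2 hnpos.le
    _ ≤ (3 + N) * m * criticalTwoPoint 3 x := mul_le_mul_of_nonneg_right hnle hGpos.le
    _ = criticalTwoPoint 3 x * m * (3 + N) := by ring

/-- The axis site `k e₀` (`k ≥ 1` an integer) is nonzero and has sup norm `k`. [folklore] -/
theorem single_axis_int_ne_zero_and_norm {k : ℤ} (hk : 1 ≤ k) :
    (Pi.single (0 : Fin 3) k : Site 3) ≠ 0 ∧ ‖(Pi.single (0 : Fin 3) k : Site 3)‖ = k := by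
  refine ⟨fun h => ?_, ?_⟩
  · have h0 := congrFun h 0
    simp only [Pi.single_eq_same, Pi.zero_apply] at h0
    omega
  · rw [norm_single_axis]
    exact abs_of_pos (by exact_mod_cast (show (0 : ℤ) < k by omega))

/-- **The Coulomb lower bound is axial and eventual**: `∃ c > 0, ∀ x ≠ 0, c/‖x‖ ≤ ⟨σ₀σ_x⟩_{β_c}`
iff `∃ c > 0`, eventually in `n`, `c ≤ n·⟨σ₀σ_{n e₀}⟩_{β_c}` (⇒: restrict to the axis, `‖n e₀‖ = n`;
⇐: `coulomb_of_eventually_axis`). [folklore] -/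
theorem coulomb_iff_eventually_axis :
    (∃ c : ℝ, 0 < c ∧ ∀ x : Site 3, x ≠ 0 → c / ‖x‖ ≤ criticalTwoPoint 3 x) ↔
      ∃ c : ℝ, 0 < c ∧ ∀ᶠ n : ℕ in atTop, c ≤ n * criticalTwoPoint 3 (Pi.single 0 (n : ℤ)) := by
  constructor
  · rintro ⟨c, hc, h⟩
    refine ⟨c, hc, ?_⟩
    filter_upwards [eventually_ge_atTop 1] with n hn
    have hnpos : (0 : ℝ) < n := by exact_mod_cast hn
    obtain ⟨hne, hnorm⟩ := single_axis_int_ne_zero_and_norm (k := (n : ℤ)) (by exact_mod_cast hn)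
    have h1 := h _ hne
    rw [hnorm, Int.cast_natCast, div_le_iff₀ hnpos, mul_comm] at h1
    exact h1
  · rintro ⟨c, hc, h⟩
    obtain ⟨N, hN⟩ := eventually_atTop.1 h
    exact coulomb_of_eventually_axis hc hN

/-- **`¬ Coulomb ↔ NonSaturation`**: the lattice Coulomb lower bound FAILS iff the infrared bound
is not saturated along the axis in the liminf sense, `∀ ε > 0, ∃ᶠ n, n·⟨σ₀σ_{n e₀}⟩_{β_c} < ε` — the
route's support item `NonSaturation` (stmt-CriticalPhenomena-1342). [folklore] -/
theorem not_coulomb_iff_nonSaturation :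
    (¬ ∃ c : ℝ, 0 < c ∧ ∀ x : Site 3, x ≠ 0 → c / ‖x‖ ≤ criticalTwoPoint 3 x) ↔
      PerfectScreening.NonSaturation := by
  rw [coulomb_iff_eventually_axis]
  simp only [PerfectScreening.NonSaturation, not_exists, not_and, Filter.not_eventually, not_le]

/-! ### §2 The logical position of the item -/

/-- **The item, contraposed**: `GaussianLimitIsCoulomb` holds iff `NonSaturation` (item 1342,
`liminf n·⟨σ₀σ_{n e₀}⟩ = 0`, the weakest form of `η > 0`) implies that EVERY non-degenerate
Möbius-covariant pointwise scaling limit of the critical correlators on `ℤ³` has `U₄ ≢ 0` (the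
Möbius-restricted form of crux `IsingEuclidUpgradeR4NonGaussian`, item 0636). The conclusion of the
item does not mention `(ρ, Δ, S)`, and its negation is `NonSaturation`
(`not_coulomb_iff_nonSaturation`). [folklore] -/
theorem gaussianLimitIsCoulomb_iff_nonSaturation_imp :
    PerfectScreening.GaussianLimitIsCoulomb ↔
      (PerfectScreening.NonSaturation →
        ∀ (ρ : ℝ → ℝ) (Δ : ℝ) (S : CorrFamily 3), (∀ δ ∈ Set.Ioc (0:ℝ) 1, 0 < ρ δ) →
          HasPointwiseScalingLimit (criticalCorr 3) ρ S → IsNondegenerateTwoPoint S →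
          IsMoebiusCovariant Δ S → HasNontrivialU4 S) := by
  constructor
  · intro h hNS ρ Δ S hρ hlim hnd hM
    by_contra hU4
    exact not_coulomb_iff_nonSaturation.2 hNS (h ρ Δ S hρ hlim hnd hM hU4)
  · intro h ρ Δ S hρ hlim hnd hM hU4
    by_contra hC
    exact hU4 (h (not_coulomb_iff_nonSaturation.1 hC) ρ Δ S hρ hlim hnd hM)

/-- **Möbius-restricted non-Gaussianity ⇒ the item** (vacuously; sharper than
`gaussianLimitIsCoulomb_of_r4NonGaussian`, which assumes non-Gaussianity of ALL non-degenerate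
pointwise limits): if every non-degenerate Möbius-covariant pointwise scaling limit of
`criticalCorr 3` has `U₄ ≢ 0`, then `GaussianLimitIsCoulomb`. [folklore] -/
theorem gaussianLimitIsCoulomb_of_moebius_nonGaussian
    (h : ∀ (ρ : ℝ → ℝ) (Δ : ℝ) (S : CorrFamily 3), (∀ δ ∈ Set.Ioc (0:ℝ) 1, 0 < ρ δ) →
      HasPointwiseScalingLimit (criticalCorr 3) ρ S → IsNondegenerateTwoPoint S →
      IsMoebiusCovariant Δ S → HasNontrivialU4 S) :
    PerfectScreening.GaussianLimitIsCoulomb :=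
  gaussianLimitIsCoulomb_iff_nonSaturation_imp.2 fun _ => h

/-- **Saturation ⇒ the item** (trivially): if the infrared bound IS saturated along the axis,
`¬ NonSaturation`, i.e. `liminf n·⟨σ₀σ_{n e₀}⟩_{β_c} > 0`, then the Coulomb bound holds outright
and so does `GaussianLimitIsCoulomb`. Together with the previous theorem: the item is open only in
the regime `NonSaturation ∧ (a Gaussian Möbius limit exists)`. [folklore] -/
theorem gaussianLimitIsCoulomb_of_not_nonSaturation (h : ¬ PerfectScreening.NonSaturation) :
    PerfectScreening.GaussianLimitIsCoulomb := by
  intro ρ Δ S _ _ _ _ _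
  by_contra hC
  exact h (not_coulomb_iff_nonSaturation.1 hC)

/-! ### §3 The renormalisation of a pointwise limit along the axis -/

section Limit

variable {ρ : ℝ → ℝ} {S : CorrFamily 3}

/-- **The renormalisation along the axis**: a pointwise scaling limit at order `2` gives
`ρ(δ)²·⟨σ₀σ_{⌊1/δ⌋ e₀}⟩_{β_c} → S₂(0, e₀)` as `δ → 0⁺` (the limit hypothesis at the
non-coincident pair `(0, e₀)`; the mesh identity `[e₀/δ] = ⌊1/δ⌋e₀` is the tree's
`rescaledCorrelator_criticalCorr_unitVec`). [folklore] -/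
theorem tendsto_rho_sq_mul_axis (hlim : HasPointwiseScalingLimit (criticalCorr 3) ρ S) :
    Tendsto (fun δ : ℝ => ρ δ ^ 2 * criticalTwoPoint 3 (Pi.single (0 : Fin 3) ⌊1 / δ⌋))
      (𝓝[>] (0 : ℝ)) (𝓝 (S 2 ![0, EuclideanSpace.single (0 : Fin 3) (1 : ℝ)])) := by
  have h := (hlim 2).tendsto_at (zero_unitVec_mem_nonCoincident (t := (1 : ℝ)) one_ne_zero)
  exact h.congr fun δ => rescaledCorrelator_criticalCorr_unitVec ρ δ

/-- The meshes `δ = 1/n` tend to `0⁺`. [folklore] -/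
theorem tendsto_one_div_nat_nhdsGT :
    Tendsto (fun n : ℕ => (1 : ℝ) / n) atTop (𝓝[>] (0 : ℝ)) := by
  rw [tendsto_nhdsWithin_iff]
  refine ⟨tendsto_one_div_atTop_nhds_zero_nat, ?_⟩
  filter_upwards [eventually_ge_atTop 1] with n hn
  have hnpos : (0 : ℝ) < n := by exact_mod_cast hn
  exact Set.mem_Ioi.2 (one_div_pos.2 hnpos)

/-- Along the meshes `δ = 1/n`: `ρ(1/n)²·⟨σ₀σ_{n e₀}⟩_{β_c} → S₂(0, e₀)`. [folklore] -/
theorem tendsto_rho_sq_mul_axis_nat (hlim : HasPointwiseScalingLimit (criticalCorr 3) ρ S) :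
    Tendsto (fun n : ℕ => ρ (1 / n) ^ 2 * criticalTwoPoint 3 (Pi.single (0 : Fin 3) (n : ℤ)))
      atTop (𝓝 (S 2 ![0, EuclideanSpace.single (0 : Fin 3) (1 : ℝ)])) := by
  have h := (tendsto_rho_sq_mul_axis hlim).comp tendsto_one_div_nat_nhdsGT
  refine h.congr' ?_
  filter_upwards [eventually_ge_atTop 1] with n hn
  simp only [Function.comp_apply, one_div_one_div, Int.floor_natCast]

/-- For `0 < δ < 1` and `k = ⌊1/δ⌋`: `1 ≤ k`, `k ≤ 1/δ` and `k⁻¹ ≤ 2δ` (as `1/δ < k + 1 ≤ 2k`).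
[folklore] -/
theorem floor_one_div_bounds {δ : ℝ} (hδ : 0 < δ) (hδ1 : δ < 1) :
    (1 : ℤ) ≤ ⌊1 / δ⌋ ∧ ((⌊1 / δ⌋ : ℤ) : ℝ) ≤ 1 / δ ∧ ((⌊1 / δ⌋ : ℤ) : ℝ)⁻¹ ≤ 2 * δ := by
  have hk1 : (1 : ℤ) ≤ ⌊1 / δ⌋ := by
    rw [Int.le_floor]; push_cast; rw [le_div_iff₀ hδ]; linarith
  have hkpos : (0 : ℝ) < ((⌊1 / δ⌋ : ℤ) : ℝ) := by exact_mod_cast (show (0 : ℤ) < ⌊1 / δ⌋ by omega)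
  refine ⟨hk1, Int.floor_le _, ?_⟩
  rw [inv_le_comm₀ hkpos (by positivity)]
  have h1 : 1 / δ < ((⌊1 / δ⌋ : ℤ) : ℝ) + 1 := Int.lt_floor_add_one _
  have h2 : (1 : ℝ) ≤ ((⌊1 / δ⌋ : ℤ) : ℝ) := by exact_mod_cast hk1
  have h3 : (2 * δ)⁻¹ = (1 / δ) / 2 := by
    field_simp
  rw [h3]
  linarith

/-- **Infrared bound ⇒ the renormalisation is at least canonical**: for a pointwise scaling limit
with non-degenerate two-point function, `ρ(δ)² ≥ c/δ` for all small `δ > 0` (`c > 0`): indeed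
`ρ(δ)²·⟨σ₀σ_{⌊1/δ⌋e₀}⟩ → A > 0` while `⟨σ₀σ_{k e₀}⟩_{β_c} ≤ C/k` (`criticalTwoPoint_bounds_holds`)
and `1/⌊1/δ⌋ ≤ 2δ`. [folklore] -/
theorem renormalisation_lower_bound (hlim : HasPointwiseScalingLimit (criticalCorr 3) ρ S)
    (hnd : IsNondegenerateTwoPoint S) :
    ∃ c : ℝ, 0 < c ∧ ∀ᶠ δ : ℝ in 𝓝[>] (0 : ℝ), c / δ ≤ ρ δ ^ 2 := by
  obtain ⟨c₀, C₀, hc₀, hbd⟩ := criticalTwoPoint_bounds_holds (d := 3) le_rfl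
  set A := S 2 ![0, EuclideanSpace.single (0 : Fin 3) (1 : ℝ)] with hA
  have hApos : 0 < A := hnd _ (zero_unitVec_mem_nonCoincident (t := (1 : ℝ)) one_ne_zero)
  -- `C₀ > 0`: at `e₀`, `0 < c₀ ≤ G(e₀) ≤ C₀`.
  have hC₀ : 0 < C₀ := by
    obtain ⟨hne, hn⟩ := single_axis_int_ne_zero_and_norm (k := 1) le_rfl
    have h := hbd _ hne
    rw [hn, Int.cast_one, Real.one_rpow, Real.one_rpow, mul_one, mul_one] at h
    linarith [h.1, h.2]
  refine ⟨A / (4 * C₀), by positivity, ?_⟩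
  have hev : ∀ᶠ δ : ℝ in 𝓝[>] (0 : ℝ),
      A / 2 < ρ δ ^ 2 * criticalTwoPoint 3 (Pi.single (0 : Fin 3) ⌊1 / δ⌋) :=
    (tendsto_rho_sq_mul_axis hlim).eventually (lt_mem_nhds (by linarith))
  have hsmall : ∀ᶠ δ : ℝ in 𝓝[>] (0 : ℝ), δ ∈ Set.Ioo (0 : ℝ) 1 := Ioo_mem_nhdsGT one_pos
  filter_upwards [hev, hsmall] with δ hδ hδs
  have hδpos : 0 < δ := hδs.1
  obtain ⟨hk1, -, hkinv⟩ := floor_one_div_bounds hδpos hδs.2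
  obtain ⟨hkne, hnorm⟩ := single_axis_int_ne_zero_and_norm hk1
  -- `G(k e₀) ≤ C₀ / k ≤ 2 C₀ δ`
  have hG : criticalTwoPoint 3 (Pi.single (0 : Fin 3) ⌊1 / δ⌋) ≤ 2 * C₀ * δ := by
    have h := (hbd _ hkne).2
    rw [hnorm] at h
    refine h.trans ?_
    have h1 : ((⌊1 / δ⌋ : ℤ) : ℝ) ^ (-(((3 : ℕ) : ℝ) - 2)) = ((⌊1 / δ⌋ : ℤ) : ℝ)⁻¹ := by
      norm_num [Real.rpow_neg_one]
    rw [h1]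
    nlinarith
  -- conclude: `A/2 < ρ² G ≤ ρ² · 2C₀δ`
  have h3 : A / 2 < ρ δ ^ 2 * (2 * C₀ * δ) := hδ.trans_le (mul_le_mul_of_nonneg_left hG (sq_nonneg _))
  have h4 : ρ δ ^ 2 * (2 * C₀ * δ) = 2 * C₀ * (ρ δ ^ 2 * δ) := by ring
  rw [div_le_iff₀ hδpos, div_le_iff₀ (by positivity : (0 : ℝ) < 4 * C₀)]
  nlinarith [h3, h4]

/-- **Coulomb ⇔ bounded renormalisation.** For a pointwise scaling limit of the critical
correlators on `ℤ³` with non-degenerate two-point function (ANY renormalisation `ρ`, no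
covariance assumed), the lattice Coulomb lower bound `∃ c > 0, ∀ x ≠ 0, c/‖x‖ ≤ ⟨σ₀σ_x⟩_{β_c}`
holds iff `δ·ρ(δ)²` is bounded as `δ → 0⁺`. (⇒: `ρ²·cδ ≤ ρ²·⟨σ₀σ_{⌊1/δ⌋e₀}⟩ → A`;
⇐: along `δ = 1/n`, `n·⟨σ₀σ_{ne₀}⟩ = (n/ρ(1/n)²)·(ρ(1/n)²⟨σ₀σ_{ne₀}⟩) ≥ (A/2)/M`, then
`coulomb_iff_eventually_axis`.) [folklore] -/
theorem coulomb_iff_isBoundedUnder_renormalisation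
    (hlim : HasPointwiseScalingLimit (criticalCorr 3) ρ S) (hnd : IsNondegenerateTwoPoint S) :
    (∃ c : ℝ, 0 < c ∧ ∀ x : Site 3, x ≠ 0 → c / ‖x‖ ≤ criticalTwoPoint 3 x) ↔
      IsBoundedUnder (· ≤ ·) (𝓝[>] (0 : ℝ)) (fun δ : ℝ => δ * ρ δ ^ 2) := by
  set A := S 2 ![0, EuclideanSpace.single (0 : Fin 3) (1 : ℝ)] with hA
  have hApos : 0 < A := hnd _ (zero_unitVec_mem_nonCoincident (t := (1 : ℝ)) one_ne_zero)
  constructor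
  · rintro ⟨c, hc, h⟩
    refine ⟨(A + 1) / c, Filter.eventually_map.2 ?_⟩
    have hev : ∀ᶠ δ : ℝ in 𝓝[>] (0 : ℝ),
        ρ δ ^ 2 * criticalTwoPoint 3 (Pi.single (0 : Fin 3) ⌊1 / δ⌋) < A + 1 :=
      (tendsto_rho_sq_mul_axis hlim).eventually (gt_mem_nhds (by linarith))
    have hsmall : ∀ᶠ δ : ℝ in 𝓝[>] (0 : ℝ), δ ∈ Set.Ioo (0 : ℝ) 1 := Ioo_mem_nhdsGT one_pos
    filter_upwards [hev, hsmall] with δ hδ hδs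
    have hδpos : 0 < δ := hδs.1
    obtain ⟨hk1, hkle, -⟩ := floor_one_div_bounds hδpos hδs.2
    obtain ⟨hkne, hnorm⟩ := single_axis_int_ne_zero_and_norm hk1
    have hkpos : (0 : ℝ) < ((⌊1 / δ⌋ : ℤ) : ℝ) := by exact_mod_cast (show (0 : ℤ) < ⌊1 / δ⌋ by omega)
    -- `c δ ≤ c / k ≤ G(k e₀)` since `k ≤ 1/δ`
    have hGge : c * δ ≤ criticalTwoPoint 3 (Pi.single (0 : Fin 3) ⌊1 / δ⌋) := by
      have h1 := h _ hkne
      rw [hnorm] at h1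
      refine le_trans ?_ h1
      rw [le_div_iff₀ hkpos]
      calc c * δ * ((⌊1 / δ⌋ : ℤ) : ℝ) ≤ c * δ * (1 / δ) := by gcongr
        _ = c := by field_simp
    have h2 : ρ δ ^ 2 * (c * δ) < A + 1 :=
      (mul_le_mul_of_nonneg_left hGge (sq_nonneg _)).trans_lt hδ
    rw [le_div_iff₀ hc]
    nlinarith
  · rintro ⟨M, hM⟩
    have hM₀ : ∀ᶠ δ : ℝ in 𝓝[>] (0 : ℝ), δ * ρ δ ^ 2 ≤ M := Filter.eventually_map.1 hM
    rw [coulomb_iff_eventually_axis]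
    set M' := max M 1 with hM'
    have hM'pos : 0 < M' := lt_of_lt_of_le one_pos (le_max_right _ _)
    refine ⟨A / 2 / M', by positivity, ?_⟩
    have h1 : ∀ᶠ n : ℕ in atTop, (1 / (n : ℝ)) * ρ (1 / n) ^ 2 ≤ M :=
      tendsto_one_div_nat_nhdsGT.eventually hM₀
    have h2 : ∀ᶠ n : ℕ in atTop,
        A / 2 < ρ (1 / n) ^ 2 * criticalTwoPoint 3 (Pi.single (0 : Fin 3) (n : ℤ)) :=
      (tendsto_rho_sq_mul_axis_nat hlim).eventually (lt_mem_nhds (by linarith))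
    filter_upwards [h1, h2, eventually_ge_atTop 1] with n hn1 hn2 hn
    have hnpos : (0 : ℝ) < n := by exact_mod_cast hn
    have hρpos : 0 < ρ (1 / n) ^ 2 := by
      rcases (sq_nonneg (ρ (1 / n))).lt_or_eq with hlt | heq
      · exact hlt
      · exfalso; rw [← heq, zero_mul] at hn2; linarith
    -- `ρ(1/n)² ≤ M n ≤ M' n`
    have hρle : ρ (1 / n) ^ 2 ≤ M' * n := by
      have e : ρ (1 / n) ^ 2 = n * ((1 / (n : ℝ)) * ρ (1 / n) ^ 2) := by
        field_simp
      rw [e]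
      calc (n : ℝ) * ((1 / (n : ℝ)) * ρ (1 / n) ^ 2) ≤ n * M :=
            mul_le_mul_of_nonneg_left hn1 hnpos.le
        _ ≤ n * M' := mul_le_mul_of_nonneg_left (le_max_left _ _) hnpos.le
        _ = M' * n := mul_comm _ _
    have hG : A / 2 / ρ (1 / n) ^ 2 < criticalTwoPoint 3 (Pi.single (0 : Fin 3) (n : ℤ)) := by
      rw [div_lt_iff₀ hρpos]; linarith
    have hn0 : (n : ℝ) ≠ 0 := hnpos.ne'
    have hM'0 : M' ≠ 0 := hM'pos.ne'
    calc A / 2 / M' = (A / 2 / (M' * n)) * n := by field_simp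
      _ ≤ (A / 2 / ρ (1 / n) ^ 2) * n :=
          mul_le_mul_of_nonneg_right (div_le_div_of_nonneg_left (by positivity) hρpos hρle)
            hnpos.le
      _ ≤ criticalTwoPoint 3 (Pi.single (0 : Fin 3) (n : ℤ)) * n :=
          mul_le_mul_of_nonneg_right hG.le hnpos.le
      _ = n * criticalTwoPoint 3 (Pi.single (0 : Fin 3) (n : ℤ)) := mul_comm _ _

end Limit

/-- **The renormalisation form of the item.** `GaussianLimitIsCoulomb` holds iff every
non-degenerate, Möbius-covariant, Gaussian (`U₄ ≡ 0` off the diagonals) pointwise scaling limit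
of the critical correlators on `ℤ³` is reached with a renormalisation `ρ(δ) = O(δ^{-1/2})`, i.e.
`δ·ρ(δ)²` bounded as `δ → 0⁺` — together with `renormalisation_lower_bound` (`ρ(δ)² ≥ c/δ`), with
the CANONICAL free-field renormalisation `ρ(δ)² ≍ δ^{-1} = δ^{-(d-2)}` ("`Z ∈ (0, ∞)`": a free
limit of the nearest-neighbour model is mean-field normalised, as for `d ≥ 5`). [folklore] -/
theorem gaussianLimitIsCoulomb_iff_canonicalRenormalisation :
    PerfectScreening.GaussianLimitIsCoulomb ↔
      ∀ (ρ : ℝ → ℝ) (Δ : ℝ) (S : CorrFamily 3), (∀ δ ∈ Set.Ioc (0:ℝ) 1, 0 < ρ δ) →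
        HasPointwiseScalingLimit (criticalCorr 3) ρ S → IsNondegenerateTwoPoint S →
        IsMoebiusCovariant Δ S → ¬ HasNontrivialU4 S →
          IsBoundedUnder (· ≤ ·) (𝓝[>] (0 : ℝ)) (fun δ : ℝ => δ * ρ δ ^ 2) := by
  constructor
  · intro h ρ Δ S hρ hlim hnd hM hU4
    exact (coulomb_iff_isBoundedUnder_renormalisation hlim hnd).1 (h ρ Δ S hρ hlim hnd hM hU4)
  · intro h ρ Δ S hρ hlim hnd hM hU4
    exact (coulomb_iff_isBoundedUnder_renormalisation hlim hnd).2 (h ρ Δ S hρ hlim hnd hM hU4)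

/-- **Two-sided canonical renormalisation under the item**: if `GaussianLimitIsCoulomb` holds,
every Gaussian Möbius limit as in the item has `c/δ ≤ ρ(δ)² ≤ C/δ` for all small `δ > 0`
(`0 < c`), the lower half being unconditional (`renormalisation_lower_bound`). [folklore] -/
theorem renormalisation_two_sided_of_gaussianLimitIsCoulomb
    (h : PerfectScreening.GaussianLimitIsCoulomb) {ρ : ℝ → ℝ} {Δ : ℝ} {S : CorrFamily 3}
    (hρ : ∀ δ ∈ Set.Ioc (0:ℝ) 1, 0 < ρ δ) (hlim : HasPointwiseScalingLimit (criticalCorr 3) ρ S)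
    (hnd : IsNondegenerateTwoPoint S) (hM : IsMoebiusCovariant Δ S) (hU4 : ¬ HasNontrivialU4 S) :
    ∃ c C : ℝ, 0 < c ∧ ∀ᶠ δ : ℝ in 𝓝[>] (0 : ℝ), c / δ ≤ ρ δ ^ 2 ∧ ρ δ ^ 2 ≤ C / δ := by
  obtain ⟨c, hc, hlow⟩ := renormalisation_lower_bound hlim hnd
  obtain ⟨M, hM'⟩ :=
    gaussianLimitIsCoulomb_iff_canonicalRenormalisation.1 h ρ Δ S hρ hlim hnd hM hU4
  have hM₀ : ∀ᶠ δ : ℝ in 𝓝[>] (0 : ℝ), δ * ρ δ ^ 2 ≤ M := Filter.eventually_map.1 hM'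
  refine ⟨c, M, hc, ?_⟩
  have hpos : ∀ᶠ δ : ℝ in 𝓝[>] (0 : ℝ), 0 < δ := eventually_mem_nhdsWithin
  filter_upwards [hlow, hM₀, hpos] with δ h1 h2 hδ
  refine ⟨h1, ?_⟩
  rw [le_div_iff₀ hδ, mul_comm]
  exact h2

end Summit.CriticalPhenomena.Ising3DConformalLimit.PerfectScreeningGaussianLimitIsCoulomb

end
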